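import Summits.QuantumFields.YangMills.Theorems.BalabanUVNodesN09CentralWindowNondegenerateBase
import Literature.MathematicalPhysics.QuantumFieldTheory.Balaban1983to89.B12ContinuousTransportInvarianceOn
import Literature.MathematicalPhysics.QuantumFieldTheory.Balaban1983to89.HaarExpChartLocalFaceTransport
import Mathlib.Analysis.Calculus.InverseFunctionTheorem.FDeriv

/-!
# NODE N09 [B12] — (O′)∕(O-int): THE ONE-VARIABLE (0.4) AVERAGE IS AN OPEN MAP AT EVERY POINT OF THE CENTRAL `α`-WINDOW, FOR EVERY ENVIRONMENT (inverse-function theorem on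
# dag-n09-w4 g5's jointly analytic chart model, pushed through the exponential chart)

Cell `pub-ymgap` (YM-PLAN Track A), width seat `pub-ymgap-dag-n09-w6` g4, FILE 7; helper of K1⁹ `StabilityBRunRowsAtRecordR13SepCoPHV` = stmt-QuantumFields-27364
(`--supports`, `--as helper`, count-neutral).  [I] = [Balaban1987RG1].  CONSUMED BY NAME (nothing modified): dag-n09-w4 g5's 6b `…N09CentralWindowChart` (★★ `contDiffAt_modelChart` — the
chart read `Φ((V,B),X) = proj(log(Ê(V,B)⋆·Ê(V,B·e^X)))` is `C^ω` jointly; `coe_fibreMap_eq_modelE`, `modelChart_apply_eq_logChart`, `fibreSmall_of_mem_window`, `coe_expChart_SU`), 6d₁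
`…N09CentralWindowNondegenerateBase` (★★★ `sliceDeriv_surjective` — n07-w2's onto central response at every window point), pub-balaban p28 `HaarExponentialChart.IsChartRep`
(`expChart`, `logChart`, `window`, `expChart_logChart`, `logChart_expChart`, `isOpen_window`, `continuous_expChart`), `BlockAveragingEMLHaarAC` (`fibreMap`, `avgFun_update_centralBond_self`,
`isOpen_fibreGuard`), `B12ContinuousTransportInvarianceOn.continuous_dist1_SU`, and Mathlib's inverse-function-theorem half
`HasStrictFDerivAt.map_nhds_eq_of_surj`.

WHY.  After dag-n09-w5 g5's tower re-run, the road-A′ instance of the (F1) regularity tower displays about the one-variable (0.4) average exactly two OPENNESS binders: (O-int) «the image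
window `T_c(U) = Ū′(c)(Ωα c U)` is a neighbourhood of `Ū′(c)(g)` for every STRICT window point `g`» (their `hopen`, reduced by p633509 `windowOpenness_of_map_nhds_eq` to
`map (g' ↦ Ū(U[β c ↦ g'])(c)) (𝓝 g) = 𝓝 (Ū(U[β c ↦ g])(c))`) and (O) (parametric openness at the critical configuration, this seat's p632316).  THIS FILE proves (O-int), in fact at
EVERY window point (not only strict ones): the one-bond (0.4) average is an OPEN MAP there.  dag-n09-w4 g5 declined the piece in this seat's favour (I.37976) with the recipe followed here.

HOW.  In W-coordinates (`W = pre·g·post`, `E = fibreMap ℰ U c`, `Ū(U[β c ↦ g])(c) = E(W)`): the slice `ψ(X) = Φ((V(U), ↑W₁), X)` of dag-n09-w4's chart model at a window point `W₁` is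
`C^ω` at `0` with ONTO derivative (`sliceDeriv_surjective`), so `map ψ (𝓝 0) = 𝓝 0` (Mathlib's `HasStrictFDerivAt.map_nhds_eq_of_surj`); near `0` the slice IS the chart read,
`E(W₁·Θ X) = E(W₁)·Θ(ψ X)` (`modelChart_apply_eq_logChart` + `expChart_logChart`); and `X ↦ k·Θ X` pushes `𝓝 0` to `𝓝 k` (`Θ` is continuous and its small windows are open
neighbourhoods of `1`).  Hence `map E (𝓝 W₁) = 𝓝 (E W₁)`; the `g`-variable and image-window editions follow by the bi-translation `g ↦ pre·g·post` and `Filter.image_mem_map`.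

CONTENT (theorems only; 0 `def`, 0 `instance`, 0 `notation`, 0 `sorry`).  §1 `map_expChart_nhds_zero` · `map_mul_expChart_nhds_zero`; §2 `continuousAt_fibreMap_of_fibreSmall` ·
★★ `map_nhds_modelSlice_eq` · `eventually_fibreMap_mul_expChart_eq` · ★★★ `map_nhds_fibreMap_eq_of_mem_centralWindow`; §3 ★★★ `map_nhds_oneVariable_eq_of_mem_centralWindow` (generic torus) ·
`isOpen_strictCentralWindowSet` · ★★ `imageWindow_mem_nhds_of_mem_strictCentralWindow`; §4 at the record (`j < K`, `avOfRecord`) ★★★ `map_nhds_oneVariable_record_eq_of_mem_strictCentralWindow`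
(dag-n09-w5 g5's `hmap` shape VERBATIM) · ★★ `imageWindow_record_mem_nhds_of_mem_strictCentralWindow` (their `hopen` shape VERBATIM).

HONEST FRAMING.  Count-neutral classical inverse-function-theorem bookkeeping BY NAME on dag-n09-w4's typed chart model; the numerics `α ≤ 1∕24`, `α < δ_N`, `157·α < L^{−(d−1)}`
stay displayed; (O) (the environment direction at the critical configuration) is NOT touched here; nothing of Bałaban's estimates asserted; `hreg` NOT discharged; N09 NOT discharged;
conjunct 1 (Lemma 4) ∕ FLAG №7 untouched; K0⁷ ∕ K1⁹ ∕ K3⁸ NOT closed; counts unmoved (typed 28∕28 · discharged 5∕28); no summit statement is proved by this seat; one finite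
four-torus programme at fixed `ε` — R4 closes the conditional rung `BalabanLadder.UV` only; NOT continuum ∕ ℝ⁴ ∕ OS; the Yang–Mills mass gap (Clay) is NOT proved by any of this.
-/

noncomputable section

open scoped Matrix.Norms.L2Operator Topology ContDiff
open Filter Set Function NormedSpace

namespace Summit.QuantumFields.YangMills.BalabanUVNodes.N09CentralWindowOpenMapping

open Literature.MathematicalPhysics.QuantumFieldTheory.Balaban1983to89
open Literature.MathematicalPhysics.QuantumFieldTheory.Balaban1983to89.T4Continuum (T4Family)
open Literature.MathematicalPhysics.QuantumFieldTheory.Balaban1983to89.HaarExponentialChart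
open Literature.MathematicalPhysics.QuantumFieldTheory.Balaban1983to89.HaarExponentialChart.IsChartRep
open Literature.MathematicalPhysics.QuantumFieldTheory.Balaban1983to89.BlockAveraging (Small Idx avgFun loopHol)
open Literature.MathematicalPhysics.QuantumFieldTheory.Balaban1983to89.BlockAveragingHaarAC (centralBond pre post openHol IsCentral)
open Literature.MathematicalPhysics.QuantumFieldTheory.Balaban1983to89.BlockAveragingEMLHaarAC (fibreFamily fibreMap FibreSmall fibreGuard
  fibreFamily_of_isCentral coe_fibreFamily_of_not_isCentral dist1_fibreFamily_of_not_isCentral avgFun_update_centralBond_self isOpen_fibreGuard)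
open Literature.MathematicalPhysics.QuantumFieldTheory.Balaban1983to89.ExpMeanLog (eml expMeanLogSU deltaSU)
open Literature.MathematicalPhysics.QuantumFieldTheory.Balaban1983to89.MatrixLog (mlog mlog_one)
open Literature.MathematicalPhysics.QuantumFieldTheory.Balaban1983to89.Node00
open Literature.MathematicalPhysics.QuantumLattice (fundamentalRep fundamentalRep_apply continuous_fundamentalRep)
open Summit.QuantumFields.YangMills.BalabanUVNodes.N09CentralWindowChart
  (contDiffAt_modelE contDiffAt_modelChart coe_fibreMap_eq_modelE modelChart_apply_eq_logChart fibreSmall_of_mem_window coe_expChart_SU)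
open Summit.QuantumFields.YangMills.BalabanUVNodes.N09CentralWindowNondegenerate (sliceDeriv_surjective)

variable {N : ℕ} [NeZero N]

/-! ## §1  Chart transport of neighbourhood filters in `SU(N)` -/

/-- The exponential chart pushes `𝓝 0` to `𝓝 1`: `Θ` is continuous with `Θ 0 = 1`, and its windows `Θ(B(0,s))`, `s ≤ s_C`, are open neighbourhoods of `1`.
[cite: Helgason2000, Ch. I §1 Thm. 1.14 (13) p. 96; BourbakiGT1, Ch. I §10 no. 2, Thm 1 Cor. 5 (bookkeeping)] -/
theorem map_expChart_nhds_zero :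
    map (isChartRep_specialUnitaryGroup (n := Fin N)).expChart (𝓝 (0 : (specialUnitaryLogChart (Fin N)).lie)) = 𝓝 (1 : SU N) := by
  apply le_antisymm
  · have h := (isChartRep_specialUnitaryGroup (n := Fin N)).continuous_expChart.tendsto (0 : (specialUnitaryLogChart (Fin N)).lie)
    rwa [IsChartRep.expChart_zero] at h
  · refine Filter.le_map fun s hs => ?_
    obtain ⟨ε, hε, hball⟩ := Metric.mem_nhds_iff.1 hs
    have hr : min ε (chartRadius (specialUnitaryLogChart (Fin N))) ≤ chartRadius (specialUnitaryLogChart (Fin N)) := min_le_right _ _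
    have hsub : (isChartRep_specialUnitaryGroup (n := Fin N)).window (min ε (chartRadius (specialUnitaryLogChart (Fin N)))) ⊆
        (isChartRep_specialUnitaryGroup (n := Fin N)).expChart '' s :=
      Set.image_mono ((Metric.ball_subset_ball (min_le_left _ _)).trans hball)
    exact mem_of_superset (((isChartRep_specialUnitaryGroup (n := Fin N)).isOpen_window hr).mem_nhds
      ((isChartRep_specialUnitaryGroup (n := Fin N)).one_mem_window (lt_min hε chartRadius_pos))) hsub

/-- `X ↦ k·Θ X` pushes `𝓝 0` to `𝓝 k`. [cite: Helgason2000, Ch. I §1 Thm. 1.14 (13) p. 96 (bookkeeping)] -/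
theorem map_mul_expChart_nhds_zero (k : SU N) :
    map (fun X : (specialUnitaryLogChart (Fin N)).lie => k * (isChartRep_specialUnitaryGroup (n := Fin N)).expChart X)
      (𝓝 (0 : (specialUnitaryLogChart (Fin N)).lie)) = 𝓝 k := by
  have h : (fun X : (specialUnitaryLogChart (Fin N)).lie => k * (isChartRep_specialUnitaryGroup (n := Fin N)).expChart X) =
      (fun g : SU N => k * g) ∘ (isChartRep_specialUnitaryGroup (n := Fin N)).expChart := rfl
  rw [h, ← Filter.map_map, map_expChart_nhds_zero, map_mul_left_nhds, mul_one]

/-! ## §2  The fibre map `E = fibreMap ℰ U c` is an open map at every window point -/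

variable {P : Params} {j : ℕ}

/-- The fibre map is continuous at every guard point (there `↑(E W) = Ê(V(U), ↑W)`, `Ê` jointly `C^∞`). [cite: Balaban1987RG1, (0.4) p.253] -/
theorem continuousAt_fibreMap_of_fibreSmall (U : GaugeField P j (SU N)) (c : PBond P (j + 1)) {W₁ : SU N}
    (hW₁ : FibreSmall (expMeanLogSU (n := Fin N)) U c W₁) :
    ContinuousAt (fibreMap (expMeanLogSU (n := Fin N)) U c) W₁ := by
  haveI : Nonempty (Fin N) := ⟨⟨0, Nat.pos_of_ne_zero (NeZero.ne N)⟩⟩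
  rw [Topology.IsInducing.subtypeVal.continuousAt_iff]
  -- the matrix model is continuous at `(V(U), ↑W₁)`
  have hsmall : ∀ i, ¬ IsCentral c i → ‖((openHol U c i : SU N) : Matrix (Fin N) (Fin N) ℂ) * star (W₁ : Matrix (Fin N) (Fin N) ℂ) - 1‖ < 1 := by
    intro i hi
    have h := hW₁ i
    rw [dist1_fibreFamily_of_not_isCentral U c W₁ i hi] at h
    exact h.trans (show ExpMeanLog.deltaSU (Fin N) < 1 from (min_le_left _ _).trans_lt (by norm_num))
  have hE := (contDiffAt_modelE (N := N) c (fun V A => eml (fun i : Idx P => if IsCentral c i then (1 : Matrix (Fin N) (Fin N) ℂ) else V i * star A) * A)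
    (fun _ _ => rfl) hsmall).continuousAt
  have hinner : ContinuousAt (fun W : SU N => (((fun i => ((openHol U c i : SU N) : Matrix (Fin N) (Fin N) ℂ)), (W : Matrix (Fin N) (Fin N) ℂ)) :
      (Idx P → Matrix (Fin N) (Fin N) ℂ) × Matrix (Fin N) (Fin N) ℂ)) W₁ :=
    continuousAt_const.prodMk continuous_subtype_val.continuousAt
  have hcomp := ContinuousAt.comp_of_eq hE hinner rfl
  refine hcomp.congr ?_
  filter_upwards [(isOpen_fibreGuard U c).mem_nhds (show W₁ ∈ fibreGuard (expMeanLogSU (n := Fin N)) U c from hW₁)] with W hW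
  simp only [Function.comp_apply]
  exact (coe_fibreMap_eq_modelE U c _ (fun _ _ => rfl) hW).symm

/-- ★★ **The slice of the chart model at a window point has `map ψ (𝓝 0) = 𝓝 0`** (`ψ(X) = Φ((V(U),↑W₁),X)`; `C^ω` at `0` by 6b, ONTO derivative by 6d₁; Mathlib's
`HasStrictFDerivAt.map_nhds_eq_of_surj`). [cite: Balaban1985Averaging, Prop. 3 (124) p.36; Balaban1987RG1, (2.10) p.267; Helgason2000, Ch. I §1 Thm. 1.14 (13) p. 96] -/
theorem map_nhds_modelSlice_eq (hj : j + 1 ≤ P.m + P.K) (U : GaugeField P j (SU N)) (c : PBond P (j + 1)) {α : ℝ}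
    (hα24 : α ≤ 1 / 24) (hαδ : α < deltaSU (Fin N)) (hαL : 157 * α < ((P.L : ℝ) ^ (P.d - 1))⁻¹)
    (Φ : ((Idx P → Matrix (Fin N) (Fin N) ℂ) × Matrix (Fin N) (Fin N) ℂ) × (specialUnitaryLogChart (Fin N)).lie → (specialUnitaryLogChart (Fin N)).lie)
    (hΦ : ∀ p, Φ p = HaarExpChartLocal.proj (specialUnitaryLogChart (Fin N))
      (mlog (star ((fun V A => eml (fun i : Idx P => if IsCentral c i then (1 : Matrix (Fin N) (Fin N) ℂ) else V i * star A) * A) p.1.1 p.1.2) *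
        (fun V A => eml (fun i : Idx P => if IsCentral c i then (1 : Matrix (Fin N) (Fin N) ℂ) else V i * star A) * A) p.1.1
          (p.1.2 * exp ((p.2 : (specialUnitaryLogChart (Fin N)).lie) : Matrix (Fin N) (Fin N) ℂ)))))
    {W₁ : SU N} (hW₁ : ∀ i : Idx P, dist1 (fibreFamily U c W₁ i) ≤ α) :
    map (fun X : (specialUnitaryLogChart (Fin N)).lie => Φ ((fun i => ((openHol U c i : SU N) : Matrix (Fin N) (Fin N) ℂ), (W₁ : Matrix (Fin N) (Fin N) ℂ)), X))
      (𝓝 0) = 𝓝 (Φ ((fun i => ((openHol U c i : SU N) : Matrix (Fin N) (Fin N) ℂ), (W₁ : Matrix (Fin N) (Fin N) ℂ)), 0)) := by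
  haveI : Nonempty (Fin N) := ⟨⟨0, Nat.pos_of_ne_zero (NeZero.ne N)⟩⟩
  have hfs : FibreSmall (expMeanLogSU (n := Fin N)) U c W₁ := fibreSmall_of_mem_window U c hαδ hW₁
  -- joint smoothness at `((V(U), ↑W₁), 0)`
  have h1 : ∀ i, ¬ IsCentral c i → ‖((openHol U c i : SU N) : Matrix (Fin N) (Fin N) ℂ) * star (W₁ : Matrix (Fin N) (Fin N) ℂ) - 1‖ < 1 := by
    intro i hi
    have h := hfs i
    rw [dist1_fibreFamily_of_not_isCentral U c W₁ i hi] at h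
    exact h.trans (show ExpMeanLog.deltaSU (Fin N) < 1 from (min_le_left _ _).trans_lt (by norm_num))
  have hexp0 : (W₁ : Matrix (Fin N) (Fin N) ℂ) * exp (((0 : (specialUnitaryLogChart (Fin N)).lie) : Matrix (Fin N) (Fin N) ℂ)) = (W₁ : Matrix (Fin N) (Fin N) ℂ) := by
    rw [ZeroMemClass.coe_zero, NormedSpace.exp_zero, mul_one]
  have h2 : ∀ i, ¬ IsCentral c i → ‖((openHol U c i : SU N) : Matrix (Fin N) (Fin N) ℂ) *
      star ((W₁ : Matrix (Fin N) (Fin N) ℂ) * exp (((0 : (specialUnitaryLogChart (Fin N)).lie) : Matrix (Fin N) (Fin N) ℂ))) - 1‖ < 1 := by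
    rw [hexp0]; exact h1
  have hEW : (fun V A => eml (fun i : Idx P => if IsCentral c i then (1 : Matrix (Fin N) (Fin N) ℂ) else V i * star A) * A)
      (fun i => ((openHol U c i : SU N) : Matrix (Fin N) (Fin N) ℂ)) (W₁ : Matrix (Fin N) (Fin N) ℂ) =
      ((fibreMap (expMeanLogSU (n := Fin N)) U c W₁ : SU N) : Matrix (Fin N) (Fin N) ℂ) :=
    (coe_fibreMap_eq_modelE U c _ (fun _ _ => rfl) hfs).symm
  have h3 : ‖star ((fun V A => eml (fun i : Idx P => if IsCentral c i then (1 : Matrix (Fin N) (Fin N) ℂ) else V i * star A) * A)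
        (fun i => ((openHol U c i : SU N) : Matrix (Fin N) (Fin N) ℂ)) (W₁ : Matrix (Fin N) (Fin N) ℂ)) *
      (fun V A => eml (fun i : Idx P => if IsCentral c i then (1 : Matrix (Fin N) (Fin N) ℂ) else V i * star A) * A)
        (fun i => ((openHol U c i : SU N) : Matrix (Fin N) (Fin N) ℂ))
          ((W₁ : Matrix (Fin N) (Fin N) ℂ) * exp (((0 : (specialUnitaryLogChart (Fin N)).lie) : Matrix (Fin N) (Fin N) ℂ))) - 1‖ < 1 := by
    rw [hexp0, hEW, star_coe_mul_coe_SU, sub_self, norm_zero]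
    exact one_pos
  have hΦdiff := contDiffAt_modelChart (N := N) c _ (fun _ _ => rfl) Φ hΦ h1 h2 h3
  -- the slice has strict derivative `(DΦ).comp inr` at `0`
  have hincl : HasStrictFDerivAt (fun X : (specialUnitaryLogChart (Fin N)).lie =>
      (((fun i => ((openHol U c i : SU N) : Matrix (Fin N) (Fin N) ℂ), (W₁ : Matrix (Fin N) (Fin N) ℂ)), X) :
        ((Idx P → Matrix (Fin N) (Fin N) ℂ) × Matrix (Fin N) (Fin N) ℂ) × (specialUnitaryLogChart (Fin N)).lie))
      (ContinuousLinearMap.inr ℝ ((Idx P → Matrix (Fin N) (Fin N) ℂ) × Matrix (Fin N) (Fin N) ℂ) (specialUnitaryLogChart (Fin N)).lie) 0 :=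
    (hasStrictFDerivAt_const _ _).prodMk (hasStrictFDerivAt_id _)
  have hslice := (hΦdiff.hasStrictFDerivAt (by simp)).comp (0 : (specialUnitaryLogChart (Fin N)).lie) hincl
  have hsurj := sliceDeriv_surjective hj U c hα24 hαδ hαL _ (fun _ _ => rfl) Φ hΦ hW₁
  exact hslice.map_nhds_eq_of_surj (LinearMap.range_eq_top.2 hsurj)

/-- **Near `0` the fibre map reads through the slice**: `E(W₁·Θ X) = E(W₁)·Θ(ψ X)` eventually as `X → 0` (`modelChart_apply_eq_logChart` + `expChart_logChart`; continuity of `E` at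
`W₁`). [cite: Balaban1987RG1, (0.4) p.253 and (2.10) p.267; Helgason2000, Ch. I §1 Thm. 1.14 (13) p. 96] -/
theorem eventually_fibreMap_mul_expChart_eq (U : GaugeField P j (SU N)) (c : PBond P (j + 1)) {α : ℝ} (hαδ : α < deltaSU (Fin N))
    (Φ : ((Idx P → Matrix (Fin N) (Fin N) ℂ) × Matrix (Fin N) (Fin N) ℂ) × (specialUnitaryLogChart (Fin N)).lie → (specialUnitaryLogChart (Fin N)).lie)
    (hΦ : ∀ p, Φ p = HaarExpChartLocal.proj (specialUnitaryLogChart (Fin N))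
      (mlog (star ((fun V A => eml (fun i : Idx P => if IsCentral c i then (1 : Matrix (Fin N) (Fin N) ℂ) else V i * star A) * A) p.1.1 p.1.2) *
        (fun V A => eml (fun i : Idx P => if IsCentral c i then (1 : Matrix (Fin N) (Fin N) ℂ) else V i * star A) * A) p.1.1
          (p.1.2 * exp ((p.2 : (specialUnitaryLogChart (Fin N)).lie) : Matrix (Fin N) (Fin N) ℂ)))))
    {W₁ : SU N} (hW₁ : ∀ i : Idx P, dist1 (fibreFamily U c W₁ i) ≤ α) :
    ∀ᶠ X : (specialUnitaryLogChart (Fin N)).lie in 𝓝 0,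
      fibreMap (expMeanLogSU (n := Fin N)) U c (W₁ * (isChartRep_specialUnitaryGroup (n := Fin N)).expChart X) =
        fibreMap (expMeanLogSU (n := Fin N)) U c W₁ *
          (isChartRep_specialUnitaryGroup (n := Fin N)).expChart (Φ ((fun i => ((openHol U c i : SU N) : Matrix (Fin N) (Fin N) ℂ), (W₁ : Matrix (Fin N) (Fin N) ℂ)), X)) := by
  have hfs : FibreSmall (expMeanLogSU (n := Fin N)) U c W₁ := fibreSmall_of_mem_window U c hαδ hW₁
  -- `W₁·Θ X → W₁` and stays in the (open) guard
  have hcurve : Tendsto (fun X : (specialUnitaryLogChart (Fin N)).lie => W₁ * (isChartRep_specialUnitaryGroup (n := Fin N)).expChart X) (𝓝 0) (𝓝 W₁) := by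
    rw [← map_mul_expChart_nhds_zero W₁]
    exact tendsto_map
  have hguard : ∀ᶠ X : (specialUnitaryLogChart (Fin N)).lie in 𝓝 0,
      FibreSmall (expMeanLogSU (n := Fin N)) U c (W₁ * (isChartRep_specialUnitaryGroup (n := Fin N)).expChart X) :=
    hcurve.eventually_mem ((isOpen_fibreGuard U c).mem_nhds (show W₁ ∈ fibreGuard (expMeanLogSU (n := Fin N)) U c from hfs))
  -- the quotient `E(W₁)⁻¹·E(W₁ Θ X) → 1`, hence enters the log window
  have hE := continuousAt_fibreMap_of_fibreSmall U c hfs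
  have hquot : Tendsto (fun X : (specialUnitaryLogChart (Fin N)).lie =>
      (fibreMap (expMeanLogSU (n := Fin N)) U c W₁)⁻¹ * fibreMap (expMeanLogSU (n := Fin N)) U c (W₁ * (isChartRep_specialUnitaryGroup (n := Fin N)).expChart X))
      (𝓝 0) (𝓝 1) := by
    have h := (hE.tendsto.comp hcurve).const_mul (fibreMap (expMeanLogSU (n := Fin N)) U c W₁)⁻¹
    rwa [inv_mul_cancel] at h
  have hnorm : ∀ᶠ X : (specialUnitaryLogChart (Fin N)).lie in 𝓝 0,
      ‖fundamentalRep (Fin N) ((fibreMap (expMeanLogSU (n := Fin N)) U c W₁)⁻¹ *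
          fibreMap (expMeanLogSU (n := Fin N)) U c (W₁ * (isChartRep_specialUnitaryGroup (n := Fin N)).expChart X)) - 1‖ <
        innerRadius (specialUnitaryLogChart (Fin N)) := by
    have hc : Tendsto (fun X : (specialUnitaryLogChart (Fin N)).lie => ‖fundamentalRep (Fin N) ((fibreMap (expMeanLogSU (n := Fin N)) U c W₁)⁻¹ *
        fibreMap (expMeanLogSU (n := Fin N)) U c (W₁ * (isChartRep_specialUnitaryGroup (n := Fin N)).expChart X)) - 1‖) (𝓝 0) (𝓝 0) := by
      have h := ((continuous_fundamentalRep (Fin N)).tendsto (1 : SU N)).comp hquot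
      rw [map_one] at h
      have h' := (h.sub_const (1 : Matrix (Fin N) (Fin N) ℂ)).norm
      rwa [sub_self, norm_zero] at h'
    exact hc.eventually (gt_mem_nhds innerRadius_pos)
  filter_upwards [hguard, hnorm] with X hX hk
  have hk' : ‖((((fibreMap (expMeanLogSU (n := Fin N)) U c W₁)⁻¹ *
      fibreMap (expMeanLogSU (n := Fin N)) U c (W₁ * (isChartRep_specialUnitaryGroup (n := Fin N)).expChart X) : SU N) : Matrix (Fin N) (Fin N) ℂ)) - 1‖ <
        innerRadius (specialUnitaryLogChart (Fin N)) := by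
    rwa [fundamentalRep_apply] at hk
  rw [modelChart_apply_eq_logChart U c _ (fun _ _ => rfl) Φ hΦ hfs hX hk', (isChartRep_specialUnitaryGroup (n := Fin N)).expChart_logChart hk,
    mul_inv_cancel_left]

/-- ★★★ **THE FIBRE MAP IS AN OPEN MAP AT EVERY WINDOW POINT**: `map E (𝓝 W₁) = 𝓝 (E W₁)` for `E = fibreMap ℰ U c`, every environment `U`, every coarse bond `c`, every `W₁` with
`dist1 (fibreFamily U c W₁ i) ≤ α` for all `i` (`α ≤ 1∕24`, `α < δ_N`, `157·α < L^{−(d−1)}`). [cite: Balaban1985Averaging, Prop. 3 (124) p.36; Balaban1987RG1, (0.4) p.253 and (2.10) p.267; Helgason2000, Ch. I §1 Thm. 1.14 (13) p. 96] -/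
theorem map_nhds_fibreMap_eq_of_mem_centralWindow (hj : j + 1 ≤ P.m + P.K) (U : GaugeField P j (SU N)) (c : PBond P (j + 1)) {α : ℝ}
    (hα24 : α ≤ 1 / 24) (hαδ : α < deltaSU (Fin N)) (hαL : 157 * α < ((P.L : ℝ) ^ (P.d - 1))⁻¹)
    {W₁ : SU N} (hW₁ : ∀ i : Idx P, dist1 (fibreFamily U c W₁ i) ≤ α) :
    map (fibreMap (expMeanLogSU (n := Fin N)) U c) (𝓝 W₁) = 𝓝 (fibreMap (expMeanLogSU (n := Fin N)) U c W₁) := by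
  -- the chart model (dag-n09-w4 g5's `Φ`), introduced by its defining equation
  obtain ⟨Φ, hΦ⟩ : ∃ Φ : ((Idx P → Matrix (Fin N) (Fin N) ℂ) × Matrix (Fin N) (Fin N) ℂ) × (specialUnitaryLogChart (Fin N)).lie → (specialUnitaryLogChart (Fin N)).lie,
      ∀ p, Φ p = HaarExpChartLocal.proj (specialUnitaryLogChart (Fin N))
        (mlog (star ((fun V A => eml (fun i : Idx P => if IsCentral c i then (1 : Matrix (Fin N) (Fin N) ℂ) else V i * star A) * A) p.1.1 p.1.2) *
          (fun V A => eml (fun i : Idx P => if IsCentral c i then (1 : Matrix (Fin N) (Fin N) ℂ) else V i * star A) * A) p.1.1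
            (p.1.2 * exp ((p.2 : (specialUnitaryLogChart (Fin N)).lie) : Matrix (Fin N) (Fin N) ℂ)))) := ⟨_, fun _ => rfl⟩
  have hslice := map_nhds_modelSlice_eq hj U c hα24 hαδ hαL Φ hΦ hW₁
  have hident := eventually_fibreMap_mul_expChart_eq U c hαδ Φ hΦ hW₁
  -- `ψ 0 = 0`
  have hfs : FibreSmall (expMeanLogSU (n := Fin N)) U c W₁ := fibreSmall_of_mem_window U c hαδ hW₁
  have hψ0 : Φ ((fun i => ((openHol U c i : SU N) : Matrix (Fin N) (Fin N) ℂ), (W₁ : Matrix (Fin N) (Fin N) ℂ)), 0) = 0 := by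
    have hX : FibreSmall (expMeanLogSU (n := Fin N)) U c (W₁ * (isChartRep_specialUnitaryGroup (n := Fin N)).expChart 0) := by
      rw [IsChartRep.expChart_zero, mul_one]; exact hfs
    have hk : ‖((((fibreMap (expMeanLogSU (n := Fin N)) U c W₁)⁻¹ *
        fibreMap (expMeanLogSU (n := Fin N)) U c (W₁ * (isChartRep_specialUnitaryGroup (n := Fin N)).expChart 0) : SU N) : Matrix (Fin N) (Fin N) ℂ)) - 1‖ <
          innerRadius (specialUnitaryLogChart (Fin N)) := by
      rw [IsChartRep.expChart_zero, mul_one, inv_mul_cancel, OneMemClass.coe_one, sub_self, norm_zero]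
      exact innerRadius_pos
    rw [modelChart_apply_eq_logChart U c _ (fun _ _ => rfl) Φ hΦ hfs hX hk, IsChartRep.expChart_zero, mul_one, inv_mul_cancel, (isChartRep_specialUnitaryGroup (n := Fin N)).logChart_one]
  rw [hψ0] at hslice
  calc map (fibreMap (expMeanLogSU (n := Fin N)) U c) (𝓝 W₁)
      = map (fibreMap (expMeanLogSU (n := Fin N)) U c)
          (map (fun X : (specialUnitaryLogChart (Fin N)).lie => W₁ * (isChartRep_specialUnitaryGroup (n := Fin N)).expChart X) (𝓝 0)) := by
        rw [map_mul_expChart_nhds_zero]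
    _ = map (fun X : (specialUnitaryLogChart (Fin N)).lie =>
          fibreMap (expMeanLogSU (n := Fin N)) U c (W₁ * (isChartRep_specialUnitaryGroup (n := Fin N)).expChart X)) (𝓝 0) := Filter.map_map
    _ = map (fun X : (specialUnitaryLogChart (Fin N)).lie => fibreMap (expMeanLogSU (n := Fin N)) U c W₁ *
          (isChartRep_specialUnitaryGroup (n := Fin N)).expChart (Φ ((fun i => ((openHol U c i : SU N) : Matrix (Fin N) (Fin N) ℂ), (W₁ : Matrix (Fin N) (Fin N) ℂ)), X))) (𝓝 0) :=
        Filter.map_congr hident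
    _ = map (fun Y : (specialUnitaryLogChart (Fin N)).lie => fibreMap (expMeanLogSU (n := Fin N)) U c W₁ * (isChartRep_specialUnitaryGroup (n := Fin N)).expChart Y)
          (map (fun X : (specialUnitaryLogChart (Fin N)).lie => Φ ((fun i => ((openHol U c i : SU N) : Matrix (Fin N) (Fin N) ℂ), (W₁ : Matrix (Fin N) (Fin N) ℂ)), X)) (𝓝 0)) := by
        rw [Filter.map_map]; rfl
    _ = 𝓝 (fibreMap (expMeanLogSU (n := Fin N)) U c W₁) := by rw [hslice, map_mul_expChart_nhds_zero]

/-! ## §3  The `g`-variable (one-bond average) and image-window editions, generic torus -/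

/-- ★★★ **(O-int) ∕ (O′): THE ONE-VARIABLE (0.4) AVERAGE `g ↦ Ū(U[β(c) ↦ g])(c)` IS AN OPEN MAP AT EVERY POINT OF THE CENTRAL `α`-WINDOW** (`j+1 ≤ m+K`, `α ≤ 1∕24`, `α < δ_N`,
`157·α < L^{−(d−1)}`): `map (g' ↦ Ū(U[β c ↦ g'])(c)) (𝓝 g) = 𝓝 (Ū(U[β c ↦ g])(c))` whenever `dist1 (fibreFamily U c (pre U c·g·post U c) i) ≤ α` for all `i` — through
`Ū(U[β c ↦ g'])(c) = E(pre·g'·post)` and the bi-translation homeomorphism. [cite: Balaban1985Averaging, Prop. 3 (124) p.36; Balaban1987RG1, (0.4) p.253 and (2.10) p.267] -/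
theorem map_nhds_oneVariable_eq_of_mem_centralWindow (hj : j + 1 ≤ P.m + P.K) (U : GaugeField P j (SU N)) (c : PBond P (j + 1)) {α : ℝ}
    (hα24 : α ≤ 1 / 24) (hαδ : α < deltaSU (Fin N)) (hαL : 157 * α < ((P.L : ℝ) ^ (P.d - 1))⁻¹)
    {g : SU N} (hg : ∀ i : Idx P, dist1 (fibreFamily U c (pre U c * g * post U c) i) ≤ α) :
    map (fun g' : SU N => avgFun (expMeanLogSU (n := Fin N)) (update U (centralBond c) g') c) (𝓝 g) =
      𝓝 (avgFun (expMeanLogSU (n := Fin N)) (update U (centralBond c) g) c) := by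
  have hfun : (fun g' : SU N => avgFun (expMeanLogSU (n := Fin N)) (update U (centralBond c) g') c) =
      fibreMap (expMeanLogSU (n := Fin N)) U c ∘ ((fun W : SU N => W * post U c) ∘ (fun g' : SU N => pre U c * g')) := by
    funext g'
    simp only [Function.comp_apply]
    exact avgFun_update_centralBond_self hj _ U c g'
  rw [hfun, ← Filter.map_map, ← Filter.map_map, map_mul_left_nhds, map_mul_right_nhds,
    map_nhds_fibreMap_eq_of_mem_centralWindow hj U c hα24 hαδ hαL hg, avgFun_update_centralBond_self hj (expMeanLogSU (n := Fin N)) U c g]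

/-- The STRICT central `α`-window `{g | ∀ i, dist1 (fibreFamily U c (pre U c·g·post U c) i) < α}` is open (continuous letters). [cite: Balaban1987RG1, (0.4) p.253 and (2.9) p.266 (bookkeeping)] -/
theorem isOpen_strictCentralWindowSet (U : GaugeField P j (SU N)) (c : PBond P (j + 1)) (α : ℝ) :
    IsOpen {g : SU N | ∀ i : Idx P, dist1 (fibreFamily U c (pre U c * g * post U c) i) < α} := by
  have hset : {g : SU N | ∀ i : Idx P, dist1 (fibreFamily U c (pre U c * g * post U c) i) < α} =
      ⋂ i, {g : SU N | dist1 (fibreFamily U c (pre U c * g * post U c) i) < α} := by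
    ext g; simp
  rw [hset]
  refine isOpen_iInter_of_finite fun i => isOpen_lt (B12ContinuousTransportInvarianceOn.continuous_dist1_SU.comp ?_) continuous_const
  have hW : Continuous fun g : SU N => pre U c * g * post U c := (continuous_const.mul continuous_id).mul continuous_const
  by_cases hi : IsCentral c i
  · simp only [fibreFamily, if_pos hi]
    exact continuous_const
  · simp only [fibreFamily, if_neg hi]
    exact continuous_const.mul hW.inv

/-- ★★ **THE IMAGE WINDOW IS A NEIGHBOURHOOD OF THE AVERAGE OF EVERY STRICT WINDOW POINT**: for `g` in the strict central `α`-window of `U`,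
`Ū′(c)({≤ α}-window) ∈ 𝓝 (Ū(U[β c ↦ g])(c))` (the open strict window is a neighbourhood of `g` inside the closed one; `Filter.image_mem_map`).
[cite: Balaban1985Averaging, Prop. 3 (124) p.36; Balaban1987RG1, (0.4) p.253 and (2.10) p.267] -/
theorem imageWindow_mem_nhds_of_mem_strictCentralWindow (hj : j + 1 ≤ P.m + P.K) (U : GaugeField P j (SU N)) (c : PBond P (j + 1)) {α : ℝ}
    (hα24 : α ≤ 1 / 24) (hαδ : α < deltaSU (Fin N)) (hαL : 157 * α < ((P.L : ℝ) ^ (P.d - 1))⁻¹)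
    {g : SU N} (hg : ∀ i : Idx P, dist1 (fibreFamily U c (pre U c * g * post U c) i) < α) :
    (fun g' : SU N => avgFun (expMeanLogSU (n := Fin N)) (update U (centralBond c) g') c) ''
        {g' : SU N | ∀ i : Idx P, dist1 (fibreFamily U c (pre U c * g' * post U c) i) ≤ α} ∈
      𝓝 (avgFun (expMeanLogSU (n := Fin N)) (update U (centralBond c) g) c) := by
  rw [← map_nhds_oneVariable_eq_of_mem_centralWindow hj U c hα24 hαδ hαL (fun i => (hg i).le)]
  exact Filter.image_mem_map (mem_of_superset ((isOpen_strictCentralWindowSet U c α).mem_nhds hg) fun g' hg' i => (hg' i).le)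

/-! ## §4  At the record (`F : T4Family`, `j < K`, `avOfRecord F N K j = blockAvg expMeanLogSU`): dag-n09-w5 g5's `hmap` ∕ `hopen` binder shapes VERBATIM -/

variable {F : T4Family}

/-- ★★★ **dag-n09-w5 g5's `hmap` binder, SUPPLIED**: `∀ c U g`, strict window ⟹ `map (g' ↦ Ū(U[β c ↦ g'])(c)) (𝓝 g) = 𝓝 (Ū(U[β c ↦ g])(c))` at the record's averaging (`j < K`;
`α ≤ 1∕24`, `α < δ_N`, `157·α < L^{−(d−1)}` on `F.P K`). [cite: Balaban1985Averaging, Prop. 3 (124) p.36; Balaban1987RG1, (0.4) p.253 and (2.10) p.267] -/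
theorem map_nhds_oneVariable_record_eq_of_mem_strictCentralWindow {K : ℕ} (hj : j < K) {α : ℝ}
    (hα24 : α ≤ 1 / 24) (hαδ : α < deltaSU (Fin N)) (hαL : 157 * α < ((((F.P K).L : ℝ)) ^ ((F.P K).d - 1))⁻¹) :
    ∀ (c : PBond (F.P K) (j + 1)) (U : GaugeField (F.P K) j (SU N)) (g : SU N),
      (∀ i : Idx (F.P K), dist1 (fibreFamily U c (pre U c * g * post U c) i) < α) →
        map (fun g' => (avOfRecord F N K j).avg (update U (centralBond c) g') c) (𝓝 g) = 𝓝 ((avOfRecord F N K j).avg (update U (centralBond c) g) c) := by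
  intro c U g hg
  have h := map_nhds_oneVariable_eq_of_mem_centralWindow (N09LiftInvariance29AtRecord.succ_le_range_of_lt hj) U c hα24 hαδ hαL fun i => (hg i).le
  rw [← avOfRecord_avg] at h
  exact h

/-- ★★ **dag-n09-w5 g5's `hopen` binder, SUPPLIED**: `∀ c U g`, strict window ⟹ the image window `Ū′(c)(Ωα c U) ∈ 𝓝 (Ū(U[β c ↦ g])(c))` at the record.
[cite: Balaban1985Averaging, Prop. 3 (124) p.36; Balaban1987RG1, (0.4) p.253 and (2.10) p.267] -/
theorem imageWindow_record_mem_nhds_of_mem_strictCentralWindow {K : ℕ} (hj : j < K) {α : ℝ}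
    (hα24 : α ≤ 1 / 24) (hαδ : α < deltaSU (Fin N)) (hαL : 157 * α < ((((F.P K).L : ℝ)) ^ ((F.P K).d - 1))⁻¹) :
    ∀ (c : PBond (F.P K) (j + 1)) (U : GaugeField (F.P K) j (SU N)) (g : SU N),
      (∀ i : Idx (F.P K), dist1 (fibreFamily U c (pre U c * g * post U c) i) < α) →
        (fun g' => (avOfRecord F N K j).avg (update U (centralBond c) g') c) ''
            {g' : SU N | ∀ i : Idx (F.P K), dist1 (fibreFamily U c (pre U c * g' * post U c) i) ≤ α} ∈
          𝓝 ((avOfRecord F N K j).avg (update U (centralBond c) g) c) := by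
  intro c U g hg
  have h := imageWindow_mem_nhds_of_mem_strictCentralWindow (N09LiftInvariance29AtRecord.succ_le_range_of_lt hj) U c hα24 hαδ hαL hg
  rw [← avOfRecord_avg] at h
  exact h

end Summit.QuantumFields.YangMills.BalabanUVNodes.N09CentralWindowOpenMapping

end
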